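import Literature.Computability.AlgebraicComplexity.VBPClosedUnderComposition
import Literature.Computability.AlgebraicComplexity.LayeredABPScalarRestriction
import HarnessLib

/-!
# Sinhababu–Thierauf: factors of polynomials with small algebraic branching programs have small
# algebraic branching programs (`VBP` is closed under taking factors) — NAMED FACT, with the
# PROVED transport to the weakly-skew measure `L_ws`

Topic `Computability/AlgebraicComplexity`. A. Sinhababu, T. Thierauf, *Factorization of
polynomials given by arithmetic branching programs*, comput. complexity **30**:15 (2021)
(CCC 2020, LIPIcs 169:33). Source READ (held, text layer, `paper:doi-10-1007-s00037-021-00215-0`,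
p. 17 of the journal version), **verbatim**:

> Theorem 4.1. Let `p` be a polynomial over a field `F` with characteristic `0`. For all factors
> `q` of `p`, we have `size_ABP(q) ≤ poly(size_ABP(p))`.

(= Theorem 10 of the CCC 2020 version, `paper:doi-10-4230-lipics-ccc-2020-33` p. 33:10; abstract:
"Given a multivariate polynomial computed by an arithmetic branching program (ABP) of size `s`, we
show that all its factors can be computed by arithmetic branching programs of size `poly(s)`.")
The model (p. 5 of the journal version, verbatim): "An arithmetic branching program (ABP) is a
layered directed acyclic graph with a single source node and a single sink node. An edge of an
ABP is labeled by a variable or a constant from the field. … The polynomial … computed by the ABP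
is the sum of the weights of the all possible paths from source to sink. The size of an ABP is
the number of its edges."

**What this file does.**
* §1 (THEOREMS, every commutative ring of coefficients) closes the tree's triangle
  `L_ws` ⟷ layered ABPs ⟷ inverse read-outs: `LayeredABPComputes.C_mul` (a layered program
  absorbs a constant factor at the cost of `2` vertices — the rank-one case of the tree's
  regular-representation unrolling `LayeredABPComputes.restrictScalars`),
  `HI16Skew.layeredABPComputes_of_isSkew` (a fan-in-two skew circuit with `s` gates IS a layered
  ABP on `(3s+4)(6s+4) + 2` vertices — the tree's `HI16Skew.exists_layered_readout` with its sign
  absorbed), `layeredABPComputes_of_wsComplexity_le` (`L_ws(g) ≤ r` ⟹ a layered ABP on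
  `(12r+4)(24r+4) + 2` vertices, through `L_skew ≤ 4 L_ws`), and
  `wsComplexity_le_of_layeredABPComputes` (the converse, through `LayeredABPComputes.hasInvRepr`
  and `wsComplexity_le_of_hasInvRepr`). This is Malod–Portier's `VP_ws = VBP` at the level of
  single polynomials, in the tree's currencies.
* §2 states Theorem 4.1 as a NAMED FACT (`def … : Prop`, D-0014) in the tree's model of algebraic
  branching programs, `LayeredABPComputes s p` (`AndrewsForbes2022DeterminantalIdeals.lean`: a
  LAYERED program on at most `s` vertices whose edges carry affine linear forms), with the
  polynomial bound in the fixed shape `(s + n + 2) ^ a` for ONE exponent `a` (`n` = the number of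
  variables): `SinhababuThierauf2021_abpFactorBound F`. Faithfulness of the rendering: the printed
  ABPs are layered with variable/constant labels and are measured by EDGES; a layered program on
  `s` vertices with affine labels in `n` variables becomes a printed ABP with at most
  `2 (n + 1) s²` edges (subdivide every edge `u → v` with label `c₀ + Σᵢ cᵢ xᵢ` into the `n + 1`
  two-edge paths `u —cᵢ→ wᵢ —xᵢ→ v`, `u —c₀→ w₀ —1→ v`; the program stays layered), and a printed
  ABP with `e` edges is a layered program with affine (variable or constant) labels on at most
  `2e + 2` vertices; so "`size_ABP(q) ≤ poly(size_ABP(p))`" gives `LayeredABPComputes ((s+n+2)^a) q`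
  for an absolute `a` (every polynomial in `(n+1)s²` is eventually below a power of `s + n + 2 ≥ 2`).
  The constants of the factor's program lie in `F` itself (the proof Hensel-lifts the
  factorisation `f ≡ g₀ h₀ (mod y)` of the specialised polynomial over `F`, §4 of the paper), as the
  `def` requires. Scope: characteristic ZERO only (`[CharZero F]`; Bhargav–Dwivedi–Saxena 2025,
  Question 4: positive characteristic is open), exactly as printed. Nothing is proved about the
  fact here; users take `(h : SinhababuThierauf2021_abpFactorBound F)`.
* §3 PROVES the transport the consumers asked for (work item wi-94803, route
  `ValiantsHypothesis/DefinabilityGap`, kernel `kiReconstructionWs_of_factorClosure`):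
  `SinhababuThierauf2021_abpFactorBound.wsComplexity_le` —
  `∃ a, ∀ σ (P Q : MvPolynomial σ F), P ≠ 0 → Q ∣ P → L_ws(Q) ≤ (L_ws(P) + #σ + 2) ^ a` — and the
  class-level form `IsVPwsFamily.of_dvd_of_abpFactorBound` (**`VBP = VP_ws` is closed under
  taking factors**, for families in p-boundedly many variables).

Status in the surveys (honest register): Bürgisser's 2024 survey, §3.1 (after Cor. 3.3), still
writes "It remains unknown whether the classes `VF` and `VBP` are closed under taking factors"
(it cites Dutta–Saxena–Sinhababu 2022 but not this paper); the refereed journal version above and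
the 2025 primer of Bhargav–Dwivedi–Saxena (§4.5, Thm. 8 "VBP Closure": "Sinhababu and Thierauf
[ST2021] … completely solve the open problem by proving factor closure of VBP") state it as a
theorem; it is vendored here as a named fact on the strength of the refereed source, for
characteristic zero only. `VF` (formulas) remains open (primer, §6) and is NOT claimed. Honest
framing: closure bookkeeping of Valiant's classes; `VP ≠ VNP` is NOT proved and nothing here bears
on it.

## References

* [SinhababuThierauf2021] A. Sinhababu, T. Thierauf, comput. complexity 30:15 (2021), Thm. 4.1
  (p. 17), model p. 5; CCC 2020 (LIPIcs 169:33), Thm. 10.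
* [MalodPortier2008] G. Malod, N. Portier, J. Complexity 24 (2008), Lemma 5, Prop. 5, Lemma 6
  (`VP_ws = VBP`: skew circuits and branching programs simulate each other linearly).
* [BurgisserClausenShokrollahi1997] P. Bürgisser, M. Clausen, M. A. Shokrollahi, *Algebraic
  Complexity Theory* (1997), Thm. (21.27) (path sums as entries of `(1 − A)⁻¹`).
* [HrubesYehudayoff2011] P. Hrubeš, A. Yehudayoff, Theory of Computing 7 (2011), §4.
* [Burgisser2024Completeness] P. Bürgisser, arXiv:2406.06217, §3.1 (the sentence quoted above),
  Def. 2.9 / Rem. 2.10(3) (`VBP` via weakly-skew circuits), Prop. 2.21.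
* [BhargavDwivediSaxena2025] C. S. Bhargav, P. Dwivedi, N. Saxena, *A primer on the closure of
  algebraic complexity classes under factoring*, arXiv:2506.19604, §4.5 Thm. 8, Question 4.
* [Burgisser2000] P. Bürgisser, *Completeness and Reduction in Algebraic Complexity Theory*,
  Def. 2.1 (p-bounded).
-/

noncomputable section

open MvPolynomial

namespace Literature.Computability.AlgebraicComplexity

universe u v

/-! ## §1 Layered programs absorb constants; skew circuits and `L_ws` give layered programs -/

section Bridges

variable {k : Type u} [CommRing k] {ρ : Type v}

/-- Multiplying every coefficient by `c` is multiplication by `C c` (the coefficientwise map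
`AddMonoidAlgebra.map` of `LayeredABPScalarRestriction.lean`, rank-one case). [folklore] -/
private theorem addMonoidAlgebra_map_smul_id (c : k) (g : MvPolynomial ρ k) :
    (AddMonoidAlgebra.map (c • (LinearMap.id : k →ₗ[k] k)).toAddMonoidHom g : MvPolynomial ρ k) =
      C c * g := by
  ext d
  rw [coeff_C_mul]
  rfl

/-- **A layered program absorbs a constant factor**: `LayeredABPComputes m g` gives
`LayeredABPComputes (m + 2) (C c * g)` (a new source feeding the old one with the constant `c`;
obtained as the rank-one case `R = F`, basis `{1}`, `λ = c · id` of the tree's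
regular-representation unrolling `LayeredABPComputes.restrictScalars`).
[cite: HrubesYehudayoff2011, §4] [cite: BurgisserClausenShokrollahi1997, Thm. (21.27) (proof, Case 1)] -/
theorem LayeredABPComputes.C_mul {m : ℕ} {g : MvPolynomial ρ k} (h : LayeredABPComputes m g)
    (c : k) : LayeredABPComputes (m + 2) (C c * g) := by
  have h' := h.restrictScalars (Module.Basis.singleton Unit k) (c • (LinearMap.id : k →ₗ[k] k))
  rwa [addMonoidAlgebra_map_smul_id, Fintype.card_unit, mul_one] at h'

namespace HI16Skew

open ArithCircuit

variable (P : ArithCircuit k ρ)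

/-- **A fan-in-two skew circuit with `s` gates is a layered algebraic branching program on
`(3s+4)(6s+4) + 2` vertices** computing the same polynomial: the layered digraph with
variable/constant labels of `exists_layered_readout` computes `(−1)^{3s+3} · P` as its source–sink
path sum; the sign is absorbed by `LayeredABPComputes.C_mul` (Malod–Portier: skew circuits are
branching programs, linear simulation). [cite: MalodPortier2008, Lemma 5]
[cite: Burgisser2024Completeness, Prop. 2.21] -/
theorem layeredABPComputes_of_isSkew (h2 : P.IsFanInTwo) (hsk : P.IsSkew) :
    LayeredABPComputes ((3 * P.size + 4) * (6 * P.size + 4) + 2) P.eval := by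
  classical
  obtain ⟨layer, N, s₀, t₀, hlay, hvc, hls, hlt, hev⟩ := exists_layered_readout P h2 hsk
  have hdeg : ∀ u v, (N u v).totalDegree ≤ 1 := by
    intro u v
    rcases hvc u v with ⟨x, hx⟩ | ⟨c, hc⟩
    · rw [hx]
      rcases subsingleton_or_nontrivial k with hk | hk
      · rw [Subsingleton.elim (X x : MvPolynomial ρ k) 0, totalDegree_zero]; exact Nat.zero_le _
      · rw [totalDegree_X]
    · rw [hc, totalDegree_C]; exact Nat.zero_le _
  have hABP : LayeredABPComputes ((3 * P.size + 4) * (6 * P.size + 4))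
      ((N ^ (layer t₀ - layer s₀)) s₀ t₀) :=
    ⟨_, le_rfl, layer, s₀, t₀, N, hlay, hdeg, rfl⟩
  rw [hlt, hls, Nat.sub_zero] at hABP
  rw [hev]
  exact hABP.C_mul ((-1 : k) ^ (3 * P.size + 3))

end HI16Skew

/-- **`L_ws(g) ≤ r` gives a layered algebraic branching program on `(12r+4)(24r+4) + 2`
vertices** (a size-optimal well-formed skew circuit has `L_skew(g) ≤ 4 L_ws(g)` gates,
`ArithCircuit.skewComplexity_le_four_mul_wsComplexity`; then
`HI16Skew.layeredABPComputes_of_isSkew`). The "weakly-skew circuits are branching programs"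
half of Malod–Portier's `VP_ws = VBP`, for one polynomial, over every commutative ring.
[cite: MalodPortier2008, Lemma 5, Prop. 5] [cite: BurgisserEtAl2011, §9.4 (skew vs weakly-skew)] -/
theorem layeredABPComputes_of_wsComplexity_le {g : MvPolynomial ρ k} {r : ℕ}
    (hg : wsComplexity g ≤ r) : LayeredABPComputes ((12 * r + 4) * (24 * r + 4) + 2) g := by
  obtain ⟨P, _, h2, hsk, hcomp, hsize⟩ := HI16Skew.skewComplexity_attained g
  have hs : P.size ≤ 4 * r :=
    hsize.le.trans ((ArithCircuit.skewComplexity_le_four_mul_wsComplexity g).trans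
      (Nat.mul_le_mul_left 4 hg))
  have h := HI16Skew.layeredABPComputes_of_isSkew P h2 hsk
  rw [show P.eval = g from hcomp] at h
  exact h.mono (Nat.add_le_add_right (Nat.mul_le_mul (by omega) (by omega)) 2)

/-- **A layered algebraic branching program on `m` vertices gives
`L_ws(g) ≤ ((m+3)(4(m+1)³+7)² + (m+1)²)(2 #τ + 3)`** (`LayeredABPComputes.hasInvRepr`, then the
tree's `wsComplexity_le_of_hasInvRepr`: border to an affine determinant and substitute into the
skew circuit for `det`). The "branching programs are weakly-skew circuits" half of `VP_ws = VBP`,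
for one polynomial, over every commutative ring. [cite: MalodPortier2008, Prop. 5, Lemma 6]
[cite: BurgisserClausenShokrollahi1997, Thm. (21.27)] -/
theorem wsComplexity_le_of_layeredABPComputes {τ : Type v} [Fintype τ] [DecidableEq τ]
    {g : MvPolynomial τ k} {m : ℕ} (h : LayeredABPComputes m g) :
    wsComplexity g ≤
      ((m + 1 + 2) * (4 * (m + 1) ^ 3 + 7) ^ 2 + (m + 1) * (m + 1)) * (2 * Fintype.card τ + 3) :=
  wsComplexity_le_of_hasInvRepr h.hasInvRepr

end Bridges

/-! ## §2 The named fact: Sinhababu–Thierauf 2021, Theorem 4.1 -/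

section Fact

/-- **Sinhababu–Thierauf 2021, Thm. 4.1 (NAMED FACT): factors of polynomials computed by small
algebraic branching programs have small algebraic branching programs** ("Let `p` be a polynomial
over a field `F` with characteristic `0`. For all factors `q` of `p`, we have
`size_ABP(q) ≤ poly(size_ABP(p))`", comput. complexity 30:15, p. 17; the printed ABPs are layered,
edge-labelled by variables or constants, and measured by the number of edges). Rendering in the
tree's model of layered algebraic branching programs `LayeredABPComputes` (at most `s` vertices,
affine edge labels — the two size measures are polynomially related through the number `n` of
variables, see the module docstring) with the bound in the fixed shape `(s + n + 2) ^ a` for ONE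
exponent `a`: for every `n`, all `p q ∈ F[x_0, …, x_{n-1}]` with `p ≠ 0`, `q ∣ p`, and every `s`,
a layered program for `p` on `≤ s` vertices yields one for `q` on `≤ (s + n + 2) ^ a` vertices
(constants in `F`). Characteristic zero only (`[CharZero F]`), as printed; unproved in the tree —
users take `(h : SinhababuThierauf2021_abpFactorBound F)` (e.g. `h.wsComplexity_le` below).
[cite: SinhababuThierauf2021, Thm. 4.1 (p. 17)] -/
def SinhababuThierauf2021_abpFactorBound (F : Type u) [Field F] [CharZero F] : Prop :=
  ∃ a : ℕ, ∀ (n s : ℕ) (p q : MvPolynomial (Fin n) F), p ≠ 0 → q ∣ p →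
    LayeredABPComputes s p → LayeredABPComputes ((s + n + 2) ^ a) q

end Fact

/-! ## §3 The transport to `L_ws` (PROVED): `VBP = VP_ws` is closed under taking factors, given the fact -/

section Transport

/-! ### Arithmetic of the polynomial bounds -/

/-- `(12r+4)(24r+4) + 2 + n + 2 ≤ (r + n + 2)^11`. [folklore] -/
private theorem base_le (r n : ℕ) : (12 * r + 4) * (24 * r + 4) + 2 + n + 2 ≤ (r + n + 2) ^ 11 := by
  set X := r + n + 2 with hX
  have hr : r ≤ X := by omega
  have hn : n ≤ X := by omega
  have h1 : 1 ≤ X := by omega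
  have h2 : 2 ≤ X := by omega
  have hA : (12 * r + 4) * (24 * r + 4) + 2 + n + 2 ≤ 453 * X ^ 2 := by
    have := Nat.mul_le_mul hr hr
    nlinarith
  have hB : 453 ≤ X ^ 9 := by
    calc (453 : ℕ) ≤ 2 ^ 9 := by norm_num
      _ ≤ X ^ 9 := Nat.pow_le_pow_left h2 9
  calc (12 * r + 4) * (24 * r + 4) + 2 + n + 2 ≤ 453 * X ^ 2 := hA
    _ ≤ X ^ 9 * X ^ 2 := Nat.mul_le_mul_right _ hB
    _ = X ^ 11 := by rw [← pow_add]

/-- The read-out bound below a power: `M + 3 ≤ Y`, `4 ≤ Y` give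
`(M+3)(4(M+1)³+7)² + (M+1)² ≤ Y^12`. [folklore] -/
private theorem readout_le {M Y : ℕ} (hY : 4 ≤ Y) (hM : M + 3 ≤ Y) :
    (M + 1 + 2) * (4 * (M + 1) ^ 3 + 7) ^ 2 + (M + 1) * (M + 1) ≤ Y ^ 12 := by
  have h1 : M + 1 ≤ Y := by omega
  have hY1 : 1 ≤ Y := by omega
  have hY2 : 2 ≤ Y := by omega
  have hcube : (M + 1) ^ 3 ≤ Y ^ 3 := Nat.pow_le_pow_left h1 3
  have h16 : 16 ≤ Y ^ 2 := by
    calc (16 : ℕ) = 4 ^ 2 := by norm_num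
      _ ≤ Y ^ 2 := Nat.pow_le_pow_left hY 2
  have hY3 : 1 ≤ Y ^ 3 := Nat.one_le_pow _ _ hY1
  have hinner : 4 * (M + 1) ^ 3 + 7 ≤ Y ^ 5 := by
    calc 4 * (M + 1) ^ 3 + 7 ≤ 4 * Y ^ 3 + 7 * Y ^ 3 := by
          have := Nat.mul_le_mul_left 4 hcube; omega
      _ = 11 * Y ^ 3 := by ring
      _ ≤ Y ^ 2 * Y ^ 3 := Nat.mul_le_mul_right _ (le_trans (by norm_num) h16)
      _ = Y ^ 5 := by rw [← pow_add]
  have hsq : (4 * (M + 1) ^ 3 + 7) ^ 2 ≤ Y ^ 10 := by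
    calc (4 * (M + 1) ^ 3 + 7) ^ 2 ≤ (Y ^ 5) ^ 2 := Nat.pow_le_pow_left hinner 2
      _ = Y ^ 10 := by rw [← pow_mul]
  have hfirst : (M + 1 + 2) * (4 * (M + 1) ^ 3 + 7) ^ 2 ≤ Y ^ 11 := by
    calc (M + 1 + 2) * (4 * (M + 1) ^ 3 + 7) ^ 2 ≤ Y * Y ^ 10 := Nat.mul_le_mul (by omega) hsq
      _ = Y ^ 11 := by rw [← pow_succ']
  have hsecond : (M + 1) * (M + 1) ≤ Y ^ 11 := by
    calc (M + 1) * (M + 1) ≤ Y * Y := Nat.mul_le_mul h1 h1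
      _ = Y ^ 2 := (pow_two Y).symm
      _ ≤ Y ^ 11 := Nat.pow_le_pow_right hY1 (by norm_num)
  calc (M + 1 + 2) * (4 * (M + 1) ^ 3 + 7) ^ 2 + (M + 1) * (M + 1) ≤ Y ^ 11 + Y ^ 11 :=
        Nat.add_le_add hfirst hsecond
    _ = 2 * Y ^ 11 := by ring
    _ ≤ Y * Y ^ 11 := Nat.mul_le_mul_right _ hY2
    _ = Y ^ 12 := by rw [← pow_succ']

/-- `2n + 3 ≤ (r + n + 2)^3`. [folklore] -/
private theorem vars_le (r n : ℕ) : 2 * n + 3 ≤ (r + n + 2) ^ 3 := by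
  set X := r + n + 2 with hX
  have hn : n ≤ X := by omega
  have h2 : 2 ≤ X := by omega
  have h4 : 4 ≤ X ^ 2 := by
    calc (4 : ℕ) = 2 ^ 2 := by norm_num
      _ ≤ X ^ 2 := Nat.pow_le_pow_left h2 2
  calc 2 * n + 3 ≤ 2 * X + 2 * X := by omega
    _ = 4 * X := by ring
    _ ≤ X ^ 2 * X := Nat.mul_le_mul_right _ h4
    _ = X ^ 3 := by rw [← pow_succ]

/-- The assembled bound: with `X = r + n + 2` and `M = ((12r+4)(24r+4) + 2 + n + 2)^a`,
`((M+3)(4(M+1)³+7)² + (M+1)²)(2n+3) ≤ X^(132a + 27)`. [folklore] -/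
private theorem transport_le (r n a : ℕ) :
    ((((12 * r + 4) * (24 * r + 4) + 2 + n + 2) ^ a + 1 + 2) *
        (4 * (((12 * r + 4) * (24 * r + 4) + 2 + n + 2) ^ a + 1) ^ 3 + 7) ^ 2 +
      (((12 * r + 4) * (24 * r + 4) + 2 + n + 2) ^ a + 1) *
        (((12 * r + 4) * (24 * r + 4) + 2 + n + 2) ^ a + 1)) * (2 * n + 3) ≤
      (r + n + 2) ^ (132 * a + 27) := by
  set X := r + n + 2 with hX
  set M := ((12 * r + 4) * (24 * r + 4) + 2 + n + 2) ^ a with hM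
  have h2 : 2 ≤ X := by omega
  have h1 : 1 ≤ X := by omega
  have hMle : M ≤ X ^ (11 * a) := by
    calc M ≤ (X ^ 11) ^ a := Nat.pow_le_pow_left (base_le r n) a
      _ = X ^ (11 * a) := by rw [← pow_mul]
  have hpos : 1 ≤ X ^ (11 * a) := Nat.one_le_pow _ _ h1
  have h4 : 4 ≤ X ^ 2 := by
    calc (4 : ℕ) = 2 ^ 2 := by norm_num
      _ ≤ X ^ 2 := Nat.pow_le_pow_left h2 2
  have hM3 : M + 3 ≤ X ^ (11 * a + 2) := by
    calc M + 3 ≤ X ^ (11 * a) + 3 * X ^ (11 * a) := by omega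
      _ = 4 * X ^ (11 * a) := by ring
      _ ≤ X ^ 2 * X ^ (11 * a) := Nat.mul_le_mul_right _ h4
      _ = X ^ (11 * a + 2) := by rw [← pow_add, Nat.add_comm]
  have hY4 : 4 ≤ X ^ (11 * a + 2) := by
    calc (4 : ℕ) ≤ X ^ 2 := h4
      _ ≤ X ^ (11 * a + 2) := Nat.pow_le_pow_right h1 (by omega)
  calc _ ≤ (X ^ (11 * a + 2)) ^ 12 * X ^ 3 := Nat.mul_le_mul (readout_le hY4 hM3) (vars_le r n)
    _ = X ^ (132 * a + 27) := by
        rw [← pow_mul, ← pow_add]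
        congr 1
        ring

/-! ### The transport -/

variable {F : Type u} [Field F] [CharZero F]

/-- **Given Sinhababu–Thierauf's theorem, factors are cheap for weakly-skew circuits**: there is
an absolute exponent `a` with `L_ws(Q) ≤ (L_ws(P) + #σ + 2) ^ a` for every finite type of variables
`σ` and all `P ≠ 0`, `Q ∣ P` in `F[x_σ]` — the hypothesis `hfac` of the route
`ValiantsHypothesis/DefinabilityGap` kernel `kiReconstructionWs_of_factorClosure`, in its exact
shape. Proof: rename to `Fin #σ` (`wsComplexity_rename_equiv`); `L_ws(P) = r` gives a layered
program on `(12r+4)(24r+4) + 2` vertices (`layeredABPComputes_of_wsComplexity_le`); the fact gives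
one for `Q` on `((12r+4)(24r+4) + 2 + #σ + 2)^a` vertices; back to `L_ws`
(`wsComplexity_le_of_layeredABPComputes`); the arithmetic `transport_le` bounds the result by
`(r + #σ + 2)^(132a + 27)`. [cite: SinhababuThierauf2021, Thm. 4.1 (p. 17)]
[cite: MalodPortier2008, Lemma 5, Prop. 5, Lemma 6] -/
theorem SinhababuThierauf2021_abpFactorBound.wsComplexity_le
    (h : SinhababuThierauf2021_abpFactorBound F) :
    ∃ a : ℕ, ∀ (σ : Type v) [Fintype σ] [DecidableEq σ] (P Q : MvPolynomial σ F), P ≠ 0 → Q ∣ P →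
      wsComplexity Q ≤ (wsComplexity P + Fintype.card σ + 2) ^ a := by
  obtain ⟨a, ha⟩ := h
  refine ⟨132 * a + 27, fun σ _ _ P Q hP hQ => ?_⟩
  set n := Fintype.card σ with hn
  set r := wsComplexity P with hr
  let e : σ ≃ Fin n := Fintype.equivFin σ
  have hP' : rename e P ≠ 0 := (map_ne_zero_iff _ (rename_injective _ e.injective)).2 hP
  have hQ' : rename e Q ∣ rename e P := map_dvd _ hQ
  have hws : wsComplexity (rename e P) ≤ r := (wsComplexity_rename_equiv e P).le
  have hlay := layeredABPComputes_of_wsComplexity_le hws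
  have hfac := ha n _ (rename e P) (rename e Q) hP' hQ' hlay
  have hQws := wsComplexity_le_of_layeredABPComputes hfac
  rw [wsComplexity_rename_equiv e Q, Fintype.card_fin] at hQws
  exact hQws.trans (transport_le r n a)

/-- **`VBP = VP_ws` is closed under taking factors, given Sinhababu–Thierauf's theorem** (the
class-level reading of Thm. 4.1, "ABPs are closed under factoring", for the tree's
`IsVPwsFamily` = families of p-bounded weakly-skew complexity, Bürgisser 2024 Def. 2.9 /
Rem. 2.10(3)): if `(f_n)` is a `VP_ws` family in p-boundedly many variables with `f_n ≠ 0` and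
`g_n ∣ f_n` for every `n`, then `(g_n)` is a `VP_ws` family.
[cite: SinhababuThierauf2021, Thm. 4.1 (p. 17)] [cite: Burgisser2000, Def. 2.1(1)] -/
theorem IsVPwsFamily.of_dvd_of_abpFactorBound (h : SinhababuThierauf2021_abpFactorBound F)
    {σ : ℕ → Type v} [∀ n, Fintype (σ n)] [∀ n, DecidableEq (σ n)]
    {f g : ∀ n, MvPolynomial (σ n) F} (hf : IsVPwsFamily f)
    (hσ : IsPBounded fun n => Fintype.card (σ n)) (hne : ∀ n, f n ≠ 0) (hg : ∀ n, g n ∣ f n) :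
    IsVPwsFamily g := by
  obtain ⟨a, ha⟩ := h.wsComplexity_le
  refine (IsPBounded.pow_holds (IsPBounded.add_holds (IsPBounded.add_holds hf hσ)
    (IsPBounded.const 2)) a).mono fun n => ?_
  exact ha (σ n) (f n) (g n) (hne n) (hg n)

end Transport

end Literature.Computability.AlgebraicComplexity

end
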